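import Mathlib.Topology.Metrizable.CompletelyMetrizable
import Mathlib.Topology.Baire.CompleteMetrizable
import Literature.AnabelianGeometry.SemiGraphs.TemperedOpenMapping
import Literature.AnabelianGeometry.SemiGraphs.TemperedCompactPreimage
import HarnessLib

/-!
# Tempered groups are complete, and Galois-countable tempered groups are Polish (hence Baire)

Mochizuki, *Semi-graphs of anabelioids*, Publ. RIMS **42** (2006), §3 Def. 3.1 (i) p. 33
[cite: MochizukiSemiAnbd2006, Def 3.1(i) p.33]: a tempered group "may be written as an inverse limit of
an inverse system of surjections of countable discrete topological groups" — in the tree's intrinsic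
form (`TemperedGroups.lean`) clause `complete` says that compatible coset families come from elements.
Consequences recorded here (proof-only; classical for inverse limits of discrete groups):

* `IsTempered.completeSpace_rightUniformSpace` — a tempered group is COMPLETE for its right uniform
  structure (a Cauchy filter lies inside one coset of every open normal subgroup; the compatible cosets
  come from an element, to which the filter converges);
* `IsTempered.isCompletelyPseudoMetrizableSpace`, `IsTempered.baireSpace` — a tempered group with
  first-countable topology (e.g. Galois-countable, [IUTchI] Rmk. 2.5.3 (i) (T1)) is completely
  (pseudo)metrizable, hence a Baire space; with `IsTempered.t2Space` it is Polish when second countable;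
* `IsTempered.isOpenMap_of_surjective_of_isTempered` — the open mapping theorem between tempered
  groups: a continuous surjective homomorphism from a first-countable tempered group onto a
  first-countable tempered group is open (target Baire by the above; then `TemperedOpenMapping.lean`);
* `IsTempered.isHomeomorph_of_bijective` — a continuous bijective homomorphism between first-countable
  tempered groups is a homeomorphism.

Refereed pre-IUT material; nothing here bears on [IUTchIII] Cor. 3.12.
-/

namespace Literature.AnabelianGeometry.SemiGraphs

open Topology Filter Set
open scoped Uniformity Pointwise

universe u v

variable {G : Type u} [Group G] [TopologicalSpace G] [IsTopologicalGroup G]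

/-- **A tempered group is complete** for the right uniform structure of a topological group
(`IsTopologicalGroup.rightUniformSpace`, entourages `{(x, y) | y·x⁻¹ ∈ U}`): a Cauchy filter contains,
for every open normal subgroup `N`, a set inside a single coset of `N`; these cosets are compatible,
so by clause `complete` of Def. 3.1 (i) they are the cosets of one element `g`, and the filter converges
to `g` (open normal subgroups form a basis of neighbourhoods of `1`, Rmk. 3.1.2).
[cite: MochizukiSemiAnbd2006, Def 3.1(i) p.33] -/
theorem IsTempered.completeSpace_rightUniformSpace (hG : IsTempered G) :
    @CompleteSpace G (IsTopologicalGroup.rightUniformSpace G) := by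
  classical
  letI : UniformSpace G := IsTopologicalGroup.rightUniformSpace G
  refine ⟨fun {F} hF => ?_⟩
  haveI : F.NeBot := hF.1
  -- for every open normal subgroup `N`, a member of `F` inside one coset of `N`
  have hsmall : ∀ N : OpenNormalSubgroup G, ∃ S ∈ F, ∀ x ∈ S, ∀ y ∈ S, y * x⁻¹ ∈ N := by
    intro N
    have hU : {q : G × G | q.2 * q.1⁻¹ ∈ (N : Set G)} ∈ 𝓤 G := by
      rw [uniformity_eq_comap_nhds_one' G]
      exact preimage_mem_comap (N.toOpenSubgroup.mem_nhds_one)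
    obtain ⟨S, hSF, hSS⟩ := Filter.mem_prod_self_iff.1 (hF.2 hU)
    exact ⟨S, hSF, fun x hx y hy => hSS (Set.mk_mem_prod hx hy)⟩
  choose S hSF hSS using hsmall
  have hne : ∀ N, (S N).Nonempty := fun N => Filter.nonempty_of_mem (hSF N)
  choose a ha using hne
  -- any element of `S N` represents the same coset of `M ⊇ N` as `a N`
  have hcoset : ∀ (N M : OpenNormalSubgroup G), N ≤ M → ∀ z ∈ S N,
      (QuotientGroup.mk (a N) : G ⧸ M.toSubgroup) = QuotientGroup.mk z := by
    intro N M hNM z hz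
    rw [QuotientGroup.eq]
    have h1 : z * (a N)⁻¹ ∈ M := hNM (hSS N _ (ha N) _ hz)
    have h2 : (a N)⁻¹ * z = (a N)⁻¹ * (z * (a N)⁻¹) * (a N)⁻¹⁻¹ := by group
    rw [h2]
    have hn : (M.toSubgroup).Normal := inferInstance
    exact hn.conj_mem _ h1 _
  obtain ⟨g, hg⟩ := hG.complete (fun N => (QuotientGroup.mk (a N) : G ⧸ N.toSubgroup)) (by
    intro N M hNM b hb
    -- pick a common point of `S N` and `S M`
    obtain ⟨z, hzN, hzM⟩ := Filter.nonempty_of_mem (Filter.inter_mem (hSF N) (hSF M))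
    have hbN : (QuotientGroup.mk (a N) : G ⧸ N.toSubgroup) = QuotientGroup.mk b := hb
    rw [hcoset M M le_rfl z hzM, ← hcoset N M hNM z hzN, QuotientGroup.eq]
    exact hNM (QuotientGroup.eq.1 hbN))
  -- `hg N : ↑(a N) = ↑g` in `G ⧸ N`
  refine ⟨g, ?_⟩
  have hb := hG.hasBasis_nhds_one.map (fun z => g * z)
  rw [map_mul_left_nhds_one] at hb
  rw [hb.ge_iff]
  intro N _
  refine Filter.mem_of_superset (hSF N) fun s hs => ?_
  refine ⟨g⁻¹ * s, ?_, by simp⟩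
  -- `g⁻¹ * s ∈ N`: `(a N)⁻¹ * g ∈ N` and `(a N)⁻¹ * s ∈ N`
  have h1 : (a N)⁻¹ * g ∈ N := QuotientGroup.eq.1 (hg N)
  have h2 : (a N)⁻¹ * s ∈ N := QuotientGroup.eq.1 (hcoset N N le_rfl s hs)
  have : g⁻¹ * s = ((a N)⁻¹ * g)⁻¹ * ((a N)⁻¹ * s) := by group
  rw [this]
  exact N.toSubgroup.mul_mem (N.toSubgroup.inv_mem h1) h2

/-- **A first-countable tempered group is completely (pseudo)metrizable** — the right uniform structure
is countably generated (first countability) and complete (`completeSpace_rightUniformSpace`).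
[cite: MochizukiSemiAnbd2006, Def 3.1(i) p.33] -/
theorem IsTempered.isCompletelyPseudoMetrizableSpace [FirstCountableTopology G] (hG : IsTempered G) :
    TopologicalSpace.IsCompletelyPseudoMetrizableSpace G := by
  letI : UniformSpace G := IsTopologicalGroup.rightUniformSpace G
  haveI : CompleteSpace G := hG.completeSpace_rightUniformSpace
  haveI : (𝓤 G).IsCountablyGenerated := by
    rw [uniformity_eq_comap_nhds_one' G]
    exact Filter.comap.isCountablyGenerated _ _
  exact TopologicalSpace.IsCompletelyPseudoMetrizableSpace.of_completeSpace_pseudometrizable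

/-- **A first-countable tempered group is a Baire space** (Baire category theorem for completely
pseudometrizable spaces).  With `IsTempered.t2Space` and second countability it is a Polish group.
[cite: MochizukiSemiAnbd2006, Def 3.1(i) p.33] -/
theorem IsTempered.baireSpace [FirstCountableTopology G] (hG : IsTempered G) : BaireSpace G := by
  haveI := hG.isCompletelyPseudoMetrizableSpace
  infer_instance

/-- **Open mapping theorem between tempered groups**: a continuous surjective homomorphism from a
first-countable tempered group onto a first-countable tempered group is an open map (the target is
Hausdorff — `IsTempered.t2Space` — and Baire — `IsTempered.baireSpace` —, so
`IsTempered.isOpenMap_of_surjective` applies).  E.g. the admissible quotients `Δ ↠ π₁^temp(𝒢_i)` of a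
special-fibre tower are automatically open once surjective. [cite: MochizukiSemiAnbd2006, Def 3.1(i) p.33] -/
theorem IsTempered.isOpenMap_of_surjective_of_isTempered [FirstCountableTopology G]
    {H : Type v} [Group H] [TopologicalSpace H] [IsTopologicalGroup H] [FirstCountableTopology H]
    (hG : IsTempered G) (hH : IsTempered H) (f : G →* H) (hf : Continuous f)
    (hs : Function.Surjective f) : IsOpenMap f := by
  haveI : T2Space H := hH.t2Space
  haveI : BaireSpace H := hH.baireSpace
  exact hG.isOpenMap_of_surjective f hf hs

/-- **A continuous bijective homomorphism between first-countable tempered groups is a homeomorphism**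
(hence an isomorphism of topological groups). [cite: MochizukiSemiAnbd2006, Def 3.1(i) p.33] -/
theorem IsTempered.isHomeomorph_of_bijective [FirstCountableTopology G]
    {H : Type v} [Group H] [TopologicalSpace H] [IsTopologicalGroup H] [FirstCountableTopology H]
    (hG : IsTempered G) (hH : IsTempered H) (f : G →* H) (hf : Continuous f)
    (hb : Function.Bijective f) : IsHomeomorph f :=
  ⟨hf, hG.isOpenMap_of_surjective_of_isTempered hH f hf hb.2, hb⟩

end Literature.AnabelianGeometry.SemiGraphs
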